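import Literature.AlgebraicGeometry.Frobenioids.DivisorMonoidCategoryTheoreticityCorProofsVII
import Literature.AlgebraicGeometry.Frobenioids.EquivalenceIstrSquare
import Literature.AlgebraicGeometry.Frobenioids.Thm42PerfectReduction
import Literature.AlgebraicGeometry.Frobenioids.Thm42OfPerfectionIsFrobenioid
import Literature.AlgebraicGeometry.Frobenioids.EquivalenceThm34Assembly
import Literature.AlgebraicGeometry.Frobenioids.EquivalenceUnitsStandardType
import Literature.AlgebraicGeometry.Frobenioids.Cor412OfFSMType
import Literature.AlgebraicGeometry.Frobenioids.IsometricPreSteps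
import HarnessLib

/-!
# Frobenioids I, Corollary 4.11 (i) AS TYPED for general Frobenioids over bases of FSM-type

Mochizuki, *The geometry of Frobenioids I: the general theory*, Kyushu J. Math. **62** (2008)
293–400, kurims text: Cor. 4.11 (i) p. 91, proof p. 92 l. 33 – p. 93 l. 28 ("we observe [cf. Theorem 3.4,
(i)] that we may assume without loss of generality that `C₁, C₂` are of isotropic type … it suffices to show
that `Ψ` preserves '`O^×(−)`' … [cf. Theorem 3.4 (iii); Theorem 4.2 (i)]")
[cite: MochizukiFrdI2008, Cor. 4.11 (i) p.91].

PROOF-ONLY file (seat abc-iut-L1-t14, lineage row `FrdI:Cor4.11(i)`). Seat abc-iut-L1-d6's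
`PreFrobenioid.cor411i_restrict` proves the typed `Cor411i` for THE restriction `Ψ^istr` of `Ψ` from three
transport properties of `Ψ`, `Ψ⁻¹` on the WHOLE of `C_i`: isotropic objects (Thm. 3.4 (i)), pull-back morphisms
(Thm. 3.4 (iii)) and Div-identity endomorphisms (Thm. 4.2 (i)). Over bases of FSM-type (the cell's route to
Thm. 3.4) the first two are the tree's `FrdI.isIsotropic_map` / `FrdI.thm34iii_ofFunctor_of_isOfFSMType`
(seat abc-iut-L1-t13 lineage); this file supplies the third for GENERAL (quasi-isotropic) `C_i`:

* `FrdI.isDivIdentity_map_of_isOfFSMType` — `Ψ` preserves Div-identity endomorphisms of every object of `C₁`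
  (standard type, `Φ_i` perf-factorial, FSM bases): group-like type — the `Φ_i` are trivial; otherwise Thm. 4.2
  (i) for `Ψ^istr` at the isotropic parts (`FrdI.T42.thm42i_ofFunctor_of_isOfFSMType`, seats abc-iut-w5/L1-d9
  lineages) transported along the isotropification square `istr₁ ⋙ Ψ^istr ≅ Ψ ⋙ istr₂` (seat abc-iut-w4-d088's
  `nonempty_isotropification_comp_iso`; transport `FrdI.T42.isDivIdentity_map_of_square`, seat abc-iut-w4-d068),
  the isotropification preserving and reflecting Div-identity endomorphisms (`isDivIdentity_hullMor`,
  `isDivIdentity_of_hullMor`: `Base(α^istr) = (Base h_A)⁻¹ ≫ Base α ≫ Base h_A`, Prop. 1.9 (v));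
* `PreFrobenioid.cor411i_ofFunctor_of_isOfFSMType` — the typed `(ofFunctor Φ₁ F₁).Cor411i (ofFunctor Φ₂ F₂) Ψ Ψistr`
  for THE restriction `Ψistr` of `Ψ` to the isotropic objects, under `Cor411Setting` (Div-slim bases,
  standard type, hypothesis (b)), for Frobenioids with perf-factorial `Φ_i` over bases of FSM-type — no other
  hypothesis.
No new definitions; nothing of the paper is restated; nothing here is specific to the abc programme and no
side is taken on [IUTchIII] Cor. 3.12.
-/

namespace Literature.AlgebraicGeometry.Frobenioids

open CategoryTheory Opposite

universe w v v' u u'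

namespace PreFrobenioid

variable {D : Type u} [Category.{v} D] {Φ : Dᵒᵖ ⥤ CommMonCat.{w}} {C : Type u'} [Category.{v'} C]
  {F : C ⥤ ElemFrobenioid Φ}

/-- The isotropification REFLECTS Div-identity endomorphisms: `Base(α^istr) = (Base h_A)⁻¹ ≫ Base α ≫ Base h_A`
(Prop. 1.9 (v)), so `Base(α)^*` is the identity as soon as `Base(α^istr)^*` is.
[cite: MochizukiFrdI2008, Prop. 1.9 (v) p.32] -/
theorem isDivIdentity_of_hullMor (hF : IsFrobenioid F) {A : C} (f : A ⟶ A)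
    (h : IsDivIdentity F (hullMor hF f)) : IsDivIdentity F f := by
  haveI : IsIso (Base F (hullHom hF A)) := (isIsotropicHull_hullHom hF A).2.1.2
  have hb : Base F f = Base F (hullHom hF A) ≫ Base F (hullMor hF f) ≫ inv (Base F (hullHom hF A)) := by
    rw [base_hullMor, Category.assoc, Category.assoc, IsIso.hom_inv_id, Category.comp_id,
      IsIso.hom_inv_id_assoc]
  show pull Φ (Base F f) = MonoidHom.id _
  ext x
  rw [hb, pull_comp, pull_comp, show pull Φ (Base F (hullMor hF f)) = MonoidHom.id _ from h,
    MonoidHom.id_apply, ← pull_comp, IsIso.hom_inv_id, pull_id, MonoidHom.id_apply]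

end PreFrobenioid

namespace FrdI

open PreFrobenioid

variable {D₁ : Type u} [Category.{v} D₁] {Φ₁ : D₁ᵒᵖ ⥤ CommMonCat.{w}} {C₁ : Type u'} [Category.{v'} C₁]
  {D₂ : Type u} [Category.{v} D₂] {Φ₂ : D₂ᵒᵖ ⥤ CommMonCat.{w}} {C₂ : Type u'} [Category.{v'} C₂]
  {F₁ : C₁ ⥤ ElemFrobenioid Φ₁} {F₂ : C₂ ⥤ ElemFrobenioid Φ₂}

set_option backward.isDefEq.respectTransparency false in
/-- **`Ψ` preserves Div-identity endomorphisms — of EVERY object — for Frobenioids of standard type with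
perf-factorial `Φ_i` over bases of FSM-type** (Thm. 4.2 (i), clause 2, beyond isotropic type): if `C₁` is of
group-like type then so is `C₂` (Thm. 3.4 (ii)) and every `Φ₂(Base B)` is trivial; otherwise Thm. 4.2 (i) holds
for the restriction `Ψ^istr` to the isotropic parts (`FrdI.T42.thm42i_ofFunctor_of_isOfFSMType`; `C_i^istr` of
standard and isotropic, non-group-like type) and transports along `istr₁ ⋙ Ψ^istr ≅ Ψ ⋙ istr₂`, the
isotropification preserving and reflecting Div-identity endomorphisms. [cite: MochizukiFrdI2008, Thm. 4.2 (i) p.77] -/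
theorem isDivIdentity_map_of_isOfFSMType (hF₁ : IsFrobenioid F₁) (hF₂ : IsFrobenioid F₂)
    (hD₁ : IsOfFSMType D₁) (hD₂ : IsOfFSMType D₂)
    (hpf₁ : Objectwise (fun M _ => IsPerfFactorial M) Φ₁) (hpf₂ : Objectwise (fun M _ => IsPerfFactorial M) Φ₂)
    (hs₁ : (PreFrobenioidData.ofFunctor Φ₁ F₁).IsOfStandardType)
    (hs₂ : (PreFrobenioidData.ofFunctor Φ₂ F₂).IsOfStandardType) (Ψ : C₁ ≌ C₂)
    {A : C₁} (α : A ⟶ A) (hα : IsDivIdentity F₁ α) : IsDivIdentity F₂ (Ψ.functor.map α) := by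
  have hq₁ := hs₁.quasiIsotropic
  have hq₂ := hs₂.quasiIsotropic
  by_cases hG₁ : (PreFrobenioidData.ofFunctor Φ₁ F₁).IsOfGroupLikeType
  · -- group-like type: `Φ₂(Base (Ψ A))` is trivial
    have hG₂ : (PreFrobenioidData.ofFunctor Φ₂ F₂).IsOfGroupLikeType :=
      FrdI.isOfGroupLikeType_map hF₁ hF₂ hq₁ hq₂ hD₁ hD₂ Ψ hG₁
    refine MonoidHom.ext fun x => ?_
    exact (hG₂.obj (Ψ.functor.obj A) _).trans (hG₂.obj (Ψ.functor.obj A) x).symm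
  · -- not of group-like type: Thm. 4.2 (i) for `Ψ^istr`, transported along the isotropification square
    have hG₂ : ¬ (PreFrobenioidData.ofFunctor Φ₂ F₂).IsOfGroupLikeType := fun h =>
      hG₁ (FrdI.isOfGroupLikeType_map hF₂ hF₁ hq₂ hq₁ hD₂ hD₁ Ψ.symm h)
    haveI : (isotropicObjects F₂).IsClosedUnderIsomorphisms :=
      ⟨fun e h => IsIsotropic.of_iso hF₂.isPreFrobenioid e.symm h⟩
    let Ψif := Ψ.congrFullSubcategory (FrdI.isotropicObjects_inverseImage hF₁ hq₁ hq₂ Ψ)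
    have hI₁ := isFrobenioid_istr hF₁
    have hI₂ := isFrobenioid_istr hF₂
    have hSI₁ := isOfStandardType_istr hF₁ hs₁
    have hSI₂ := isOfStandardType_istr hF₂ hs₂
    have hGI₁ : ¬ (PreFrobenioidData.ofFunctor Φ₁ (istrFunctor F₁)).IsOfGroupLikeType := fun h =>
      hG₁ (isOfGroupLikeType_of_istr' hF₁ h)
    have hGI₂ : ¬ (PreFrobenioidData.ofFunctor Φ₂ (istrFunctor F₂)).IsOfGroupLikeType := fun h =>
      hG₂ (isOfGroupLikeType_of_istr' hF₂ h)
    have hiI₁ : (PreFrobenioidData.ofFunctor Φ₁ (istrFunctor F₁)).IsOfIsotropicType :=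
      (PreFrobenioidData.ofFunctor_isOfIsotropicType _).mpr isOfIsotropicType_istr
    have hiI₂ : (PreFrobenioidData.ofFunctor Φ₂ (istrFunctor F₂)).IsOfIsotropicType :=
      (PreFrobenioidData.ofFunctor_isOfIsotropicType _).mpr isOfIsotropicType_istr
    have hT : PreFrobenioidData.Thm42Setting (PreFrobenioidData.ofFunctor Φ₁ (istrFunctor F₁))
        (PreFrobenioidData.ofFunctor Φ₂ (istrFunctor F₂)) := ⟨⟨hSI₁, hSI₂⟩, ⟨hiI₁, hiI₂⟩, ⟨hGI₁, hGI₂⟩⟩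
    have hdiI : ∀ (X : Istr F₁) (φ : X ⟶ X), (PreFrobenioidData.ofFunctor Φ₁ (istrFunctor F₁)).IsDivIdentity φ →
        (PreFrobenioidData.ofFunctor Φ₂ (istrFunctor F₂)).IsDivIdentity (Ψif.functor.map φ) :=
      (FrdI.T42.thm42i_ofFunctor_of_isOfFSMType Ψif hI₁ hI₂ hpf₁ hpf₂ hD₁ hD₂ hT).2.1
    obtain ⟨e⟩ := nonempty_isotropification_comp_iso hF₁ hF₂ hq₁ hq₂ Ψ
    exact FrdI.T42.isDivIdentity_map_of_square (F₁' := istrFunctor F₁) (F₂' := istrFunctor F₂) e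
      (fun X β hβ => isDivIdentity_hullMor hF₁ β hβ) (fun X β hβ => isDivIdentity_of_hullMor hF₂ β hβ)
      (fun X β hβ => (PreFrobenioidData.ofFunctor_isDivIdentity (istrFunctor F₂) _).mp
        (hdiI X β ((PreFrobenioidData.ofFunctor_isDivIdentity (istrFunctor F₁) β).mpr hβ)))
      α hα

end FrdI

namespace PreFrobenioid

variable {D₁ : Type u} [Category.{v} D₁] {Φ₁ : D₁ᵒᵖ ⥤ CommMonCat.{w}} {C₁ : Type u'} [Category.{v'} C₁]
  {D₂ : Type u} [Category.{v} D₂] {Φ₂ : D₂ᵒᵖ ⥤ CommMonCat.{w}} {C₂ : Type u'} [Category.{v'} C₂]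
  {F₁ : C₁ ⥤ ElemFrobenioid Φ₁} {F₂ : C₂ ⥤ ElemFrobenioid Φ₂}

set_option backward.isDefEq.respectTransparency false in
/-- **[FrdI] Cor. 4.11 (i) AS TYPED for general Frobenioids over bases of FSM-type**: for Frobenioids
`C_i → F_{Φ_i}` with perf-factorial `Φ_i` over bases of FSM-type and every equivalence `Ψ`, under the
hypotheses `Cor411Setting` of Cor. 4.11 (`D_i` Div-slim, `C_i` of standard type, hypothesis (b)) there are THE
restriction `Ψ^istr : C₁^istr ⥲ C₂^istr` of `Ψ` (Thm. 3.4 (i)) and a `1`-unique `Ψ^un-tr : C₁^un-tr ⥲ C₂^un-tr`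
`1`-commuting with the projections, both composites being rigid — the typed `Cor411i` for `Ψ^istr`. Inputs BY
NAME: seat abc-iut-L1-d6's `cor411i_restrict`; isotropic objects `FrdI.isIsotropic_map` (Thm. 3.4 (i));
pull-back morphisms `FrdI.thm34iii_ofFunctor_of_isOfFSMType` (Thm. 3.4 (iii), seat abc-iut-L1-t13 lineage);
Div-identity endomorphisms `FrdI.isDivIdentity_map_of_isOfFSMType` (Thm. 4.2 (i)).
[cite: MochizukiFrdI2008, Cor. 4.11 (i) p.91] -/
theorem cor411i_ofFunctor_of_isOfFSMType (hF₁ : IsFrobenioid F₁) (hF₂ : IsFrobenioid F₂)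
    (hD₁ : IsOfFSMType D₁) (hD₂ : IsOfFSMType D₂)
    (hpf₁ : Objectwise (fun M _ => IsPerfFactorial M) Φ₁) (hpf₂ : Objectwise (fun M _ => IsPerfFactorial M) Φ₂)
    (Ψ : C₁ ≌ C₂) (hs : (PreFrobenioidData.ofFunctor Φ₁ F₁).Cor411Setting (PreFrobenioidData.ofFunctor Φ₂ F₂) Ψ) :
    ∃ Ψistr : (PreFrobenioidData.ofFunctor Φ₁ F₁).Istr ≌ (PreFrobenioidData.ofFunctor Φ₂ F₂).Istr,
      Ψistr.functor ⋙ (PreFrobenioidData.ofFunctor Φ₂ F₂).istrι =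
          (PreFrobenioidData.ofFunctor Φ₁ F₁).istrι ⋙ Ψ.functor ∧
        (PreFrobenioidData.ofFunctor Φ₁ F₁).Cor411i (PreFrobenioidData.ofFunctor Φ₂ F₂) Ψ Ψistr.functor := by
  have hs₁ := hs.standard.1
  have hs₂ := hs.standard.2
  have hq₁ := hs₁.quasiIsotropic
  have hq₂ := hs₂.quasiIsotropic
  have hB := hs.hypB
  have hB' : (PreFrobenioidData.ofFunctor Φ₂ F₂).HypB (PreFrobenioidData.ofFunctor Φ₁ F₁) Ψ.symm :=
    fun g₂ g₁ => ⟨(hB g₁ g₂).2, (hB g₁ g₂).1⟩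
  -- Thm. 3.4 (i): isotropic objects are preserved by `Ψ` and by `Ψ⁻¹`
  have hiso : ∀ A : C₁, (PreFrobenioidData.ofFunctor Φ₂ F₂).IsIsotropic (Ψ.functor.obj A) ↔
      (PreFrobenioidData.ofFunctor Φ₁ F₁).IsIsotropic A := fun A =>
    ⟨fun h => (PreFrobenioidData.ofFunctor_isIsotropic F₁ A).mpr
        (IsIsotropic.of_iso hF₁.isPreFrobenioid (Ψ.unitIso.app A)
          (FrdI.isIsotropic_map hq₂ hq₁ Ψ.symm ((PreFrobenioidData.ofFunctor_isIsotropic F₂ _).mp h))),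
      fun h => (PreFrobenioidData.ofFunctor_isIsotropic F₂ _).mpr
        (FrdI.isIsotropic_map hq₁ hq₂ Ψ ((PreFrobenioidData.ofFunctor_isIsotropic F₁ A).mp h))⟩
  -- Thm. 3.4 (iii): pull-back morphisms are preserved by `Ψ` and by `Ψ⁻¹`
  have h3 := FrdI.thm34iii_ofFunctor_of_isOfFSMType hF₁ hF₂ hD₁ hD₂ Ψ hs₁ hs₂ hB
  have h3' := FrdI.thm34iii_ofFunctor_of_isOfFSMType hF₂ hF₁ hD₂ hD₁ Ψ.symm hs₂ hs₁ hB'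
  -- Thm. 4.2 (i): Div-identity endomorphisms are preserved by `Ψ` and by `Ψ⁻¹`
  have hdi : ∀ (A : C₁) (φ : A ⟶ A), (PreFrobenioidData.ofFunctor Φ₁ F₁).IsDivIdentity φ →
      (PreFrobenioidData.ofFunctor Φ₂ F₂).IsDivIdentity (Ψ.functor.map φ) := fun A φ hφ =>
    (PreFrobenioidData.ofFunctor_isDivIdentity F₂ _).mpr
      (FrdI.isDivIdentity_map_of_isOfFSMType hF₁ hF₂ hD₁ hD₂ hpf₁ hpf₂ hs₁ hs₂ Ψ φ
        ((PreFrobenioidData.ofFunctor_isDivIdentity F₁ φ).mp hφ))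
  have hdi' : ∀ (B : C₂) (φ : B ⟶ B), (PreFrobenioidData.ofFunctor Φ₂ F₂).IsDivIdentity φ →
      (PreFrobenioidData.ofFunctor Φ₁ F₁).IsDivIdentity (Ψ.inverse.map φ) := fun B φ hφ =>
    (PreFrobenioidData.ofFunctor_isDivIdentity F₁ _).mpr
      (FrdI.isDivIdentity_map_of_isOfFSMType hF₂ hF₁ hD₂ hD₁ hpf₂ hpf₁ hs₂ hs₁ Ψ.symm φ
        ((PreFrobenioidData.ofFunctor_isDivIdentity F₂ φ).mp hφ))
  exact cor411i_restrict F₁ F₂ Ψ hF₁ hF₂ hiso hs.divSlim.1 hs.divSlim.2 h3.1.2.2.2.2.1 h3'.1.2.2.2.2.1 hdi hdi'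

end PreFrobenioid

end Literature.AlgebraicGeometry.Frobenioids
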